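import Literature.AlgebraicGeometry.Frobenioids.ArchimedeanFSMMonoCondBR
import Literature.AlgebraicGeometry.Frobenioids.ArchimedeanFSMProofs
import Literature.AlgebraicGeometry.Frobenioids.ArchimedeanSlitTools
import HarnessLib

/-!
# Frobenioids II, Proposition 3.4 (iii), the POINTWISE form that survives over an arbitrary base
# (abc-iut cell, layer L1, node `FrdII:Prop3.4(iii)` — refuted as typed, repaired in the complex regime;
# this file records the per-arrow salvage valid for every base `π : D → D₀`)

Mochizuki, *The geometry of Frobenioids II: poly-Frobenioids*, Kyushu J. Math. **62** (2008)
401–460, §3, Proposition 3.4 (iii) p. 30, proof p. 31 ll. 8–11 [cite: MochizukiFrdII2008, Prop 3.4 (iii) p.31]: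
> "Assertion (iii) follows immediately from assertions (i), (ii), together with the observation
> that if `φ` is a fiberwise-surjective morphism of `F` that does not satisfy condition (a) of
> assertion (ii), then the fiberwise-surjectivity of `φ` implies [cf. Lemma 3.2, (ix)] that `φ`
> necessarily satisfies condition (b) of assertion (ii)."

PROOF-ONLY file (nothing is defined). The typed item (iii) (`ArchFrd.Prop34_iii π`: "FSM-morphisms of
`F` project to FSM-morphisms of `D`", all three towers, arbitrary base) is FALSE as typed — at
`π = 𝟭 D₀` for each of `A`, `N`, `R` (`towerA/N/R_id_not_propIII`, abc-iut-L1-d3): the printed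
"observation" fails for the half-circle FSM-arrows complex → real, which are fiberwise surjective,
violate (a), and do not project to monomorphisms. What DOES hold over every base is the part of the
printed proof before the observation — "(iii) follows from (i), (ii)" — i.e. (iii) for the FSM-morphisms
that satisfy condition (a) or condition (b) of (ii): `ArchFrd.Tower.isFSM_toD_of_condA_or_condB` (from
`prop34_i_holds`, abc-iut-L1-d3, and `prop34_ii_holds`, abc-iut-w5-d101 — item (ii) AS TYPED). In
particular (iii) holds for every FSM-morphism whose CODOMAIN lies over `Spec ℂ` (then so does the
domain, and the projection to `D₀` is an isomorphism: condition (a)) — `…isFSM_toD_of_isComplex_cod` —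
which over a base in the complex regime is the cell's repaired node `prop34_iiiR_holds` /
`prop34_iii_of_isComplex`, and over a MIXED base (real and complex places) is the usable form.
No side is taken on [IUTchIII] Cor. 3.12.
-/

namespace Literature.AlgebraicGeometry.Frobenioids

open CategoryTheory

noncomputable section

namespace ArchFrd

universe v u

variable {D : Type u} [Category.{v} D] (π : D ⥤ D0)

/-- **Prop. 3.4 (iii), pointwise, over any base**: an FSM-morphism of `F ∈ {A, N, R}` satisfying
condition (a) or condition (b) of (ii) projects to an FSM-morphism of `D` ("(iii) follows immediately
from assertions (i), (ii)"). Stated for the three towers at once.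
[cite: MochizukiFrdII2008, Prop 3.4 (iii) p.31] -/
theorem isFSM_toD_of_condA_or_condB :
    (∀ ⦃X Y : (towerA π).F⦄ (φ : X ⟶ Y), (towerA π).CondA φ ∨ (towerA π).CondB φ →
        IsFSM φ → IsFSM ((towerA π).toD.map φ)) ∧
      (∀ ⦃X Y : (towerN π).F⦄ (φ : X ⟶ Y), (towerN π).CondA φ ∨ (towerN π).CondB φ →
        IsFSM φ → IsFSM ((towerN π).toD.map φ)) ∧
      (∀ ⦃X Y : (towerR π).F⦄ (φ : X ⟶ Y), (towerR π).CondA φ ∨ (towerR π).CondB φ →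
        IsFSM φ → IsFSM ((towerR π).toD.map φ)) := by
  obtain ⟨hA, hN, hR⟩ := prop34_i_holds π
  obtain ⟨mA, mN, mR⟩ := prop34_ii_holds π
  exact ⟨fun X Y φ hc hφ => ⟨hA φ hφ.1, mA φ hφ.2 hc⟩, fun X Y φ hc hφ => ⟨hN φ hφ.1, mN φ hφ.2 hc⟩,
    fun X Y φ hc hφ => ⟨hR φ hφ.1, mR φ hφ.2 hc⟩⟩

/-- Condition (a) holds for every arrow of a tower whose codomain lies over `Spec ℂ` (an arrow of
`D₀` into `Spec ℂ` has domain `Spec ℂ` and is an isomorphism). [cite: MochizukiFrdII2008, Prop 3.4 (ii) p.30] -/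
theorem Tower.condA_of_isComplex_cod (T : Tower π) {X Y : T.F} (φ : X ⟶ Y)
    (hY : (T.toD0.obj Y).IsComplex) : T.CondA φ := by
  have hX : (T.toD0.obj X).IsComplex := by
    rcases D0.isReal_or_isComplex (T.toD0.obj X) with hr | hc
    · have hYc : T.toD0.obj Y = D0.complex := hY
      exact (D0.isEmpty_hom_real_complex.false (eqToHom hr.symm ≫ T.toD0.map φ ≫ eqToHom hYc)).elim
    · exact hc
  exact D0.isIso_of_isComplex _ hX hY

/-- **Prop. 3.4 (iii), pointwise, over any base**: an FSM-morphism of `F ∈ {A, N, R}` whose codomain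
lies over `Spec ℂ` projects to an FSM-morphism of `D` (three towers). Over a base in the complex regime
this is `prop34_iii_of_isComplex`; the typed universal item is false (`not_prop34_iii_id`).
[cite: MochizukiFrdII2008, Prop 3.4 (iii) p.31] -/
theorem isFSM_toD_of_isComplex_cod :
    (∀ ⦃X Y : (towerA π).F⦄ (φ : X ⟶ Y), ((towerA π).toD0.obj Y).IsComplex →
        IsFSM φ → IsFSM ((towerA π).toD.map φ)) ∧
      (∀ ⦃X Y : (towerN π).F⦄ (φ : X ⟶ Y), ((towerN π).toD0.obj Y).IsComplex →
        IsFSM φ → IsFSM ((towerN π).toD.map φ)) ∧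
      (∀ ⦃X Y : (towerR π).F⦄ (φ : X ⟶ Y), ((towerR π).toD0.obj Y).IsComplex →
        IsFSM φ → IsFSM ((towerR π).toD.map φ)) := by
  obtain ⟨hA, hN, hR⟩ := isFSM_toD_of_condA_or_condB π
  exact ⟨fun X Y φ hY => hA φ (Or.inl ((towerA π).condA_of_isComplex_cod π φ hY)),
    fun X Y φ hY => hN φ (Or.inl ((towerN π).condA_of_isComplex_cod π φ hY)),
    fun X Y φ hY => hR φ (Or.inl ((towerR π).condA_of_isComplex_cod π φ hY))⟩

end ArchFrd

end

end Literature.AlgebraicGeometry.Frobenioids
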